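import Summits.ResolutionOfSingularities.ResolutionOfSingularities.Theorems.HomologicalConductorNoZenoRQuadraticTransformDominated
import Summits.ResolutionOfSingularities.ResolutionOfSingularities.Theorems.HomologicalConductorNoZenoRLipman12B
import Literature.AlgebraicGeometry.Resolution.ExceptionalCurvesLocalizedResolution
import HarnessLib

/-!
# Crux `NoZenoR` (stmt-ResolutionOfSingularities-19943) — Lipman 1969, (*) p. 203 AT THE STAGES of the process of
# Theorem (4.1): over every non-regular normal point `w` of a birational model `W` of a rational `Spec S`, a
# desingularization `X → W` dominates the quadratic transform of `Spec 𝒪_{W,w}`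

Route `ResolutionOfSingularities/HomologicalConductor` (cell decomp-res, hand leafhand-res-homologicalconduct-21 g0).
OURS: AI-written proof over tree theorems, weaker than expert review; nothing here is a statement of the manuscript
under review (Hironaka 2017).  SUPPORT level, counted 0.  Def-free, FACT-FREE.

Lipman proves Theorem (4.1) (p. 204–205) by ITERATING (*) along the process «blow up a singular point, (normalise),
repeat»: "the surfaces which arise are normal and have only rational singularities [Prop. (1.2) 1)] … (*) (§2) shows that
for every desingularization `f′ : X′ → Y`, `X′` dominates `X`".  The inductive step needs (*) not for `Spec S` itself but
for the LOCAL RINGS `𝒪_{W,w}` of the intermediate surfaces `W → Spec S` (birational, of finite type) at their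
non-regular normal points `w`, applied to the desingularization `X ×_W Spec 𝒪_{W,w} → Spec 𝒪_{W,w}` induced by a
desingularization `σ : X → W`.  This file packages exactly that step from tree theorems:

* `hasRationalSingularity_stalk_of_stage` — Prop. (1.2) 1) (tree THEOREM `Lipman12B.Lipman1969_1_2_holds`): a normal
  two-dimensional local ring `𝒪_{W,w}` of an integral `W`, birational and of finite type (quasi-compact, separated)
  over the rational `Spec S`, has a rational singularity;
* **`isEffectiveCartier_baseIdeal_maximalIdeal_stalk_of_stage`** — for `σ : X → W` a resolution and such a point `w`
  which is NOT regular, `𝔪_w·𝒪` is an effective Cartier divisor on the desingularization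
  `X_w := X ×_W Spec 𝒪_{W,w} → Spec 𝒪_{W,w}` (`IsResolution.pullback_snd_fromSpecStalk`, Temkin 2008 §2.1, and
  `QuadraticTransform.isEffectiveCartier_baseIdeal_maximalIdeal`);
* **`exists_isResolution_fac_stalk_of_stage`** — hence `X_w` is a desingularization of the quadratic transform
  `Bl_{𝔪_w}(Spec 𝒪_{W,w})` (through any blowing up of `𝔪_w`).

What is still missing for Lipman's construction of the minimal desingularization (print `Lipman1969_4_1` via hand
16 g4's `Lipman1969_4_1_of_localMinimalBlowup`): Prop. (8.1) (the quadratic transform of a rational singularity is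
NORMAL — complete ideals, §§5–8; XL) or a finite normalisation step, the globalisation of the local factorisation over
`Spec 𝒪_{W,w}` to a neighbourhood of `w` in `W`, and termination (exceptional-curve count under a fixed
desingularization).  No crux, kill test or summit statement is proved here; resolution in positive characteristic is
NOT proved.

References: J. Lipman, Publ. Math. IHÉS 36 (1969): §2 (*) (p. 203), Prop. (1.2) (p. 199), Thm. (4.1) and proof
(pp. 204–205) [`Lipman1969`]; M. Temkin, *Desingularization of quasi-excellent schemes in characteristic zero*, Adv. Math.
219 (2008), §2.1 [`Temkin2008`].
-/

noncomputable section

-- single-problem summit: the doubled namespace component `ResolutionOfSingularities` is forced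
set_option linter.dupNamespace false

open CategoryTheory CategoryTheory.Limits AlgebraicGeometry TopologicalSpace Opposite IsLocalRing
open Literature.AlgebraicGeometry.Morphisms Literature.AlgebraicGeometry.Modules
open Literature.AlgebraicGeometry.Resolution

namespace Summit.ResolutionOfSingularities.ResolutionOfSingularities.Theorems.NoZeno.QuadraticTransform

variable {S : Type} [CommRing S] [IsNoetherianRing S] [IsLocalRing S] [IsDomain S] [IsIntegrallyClosed S]
  {W : Scheme.{0}} [IsIntegral W] (g : W ⟶ Spec (.of S)) [LocallyOfFiniteType g] [QuasiCompact g]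
  [IsSeparated g] {X : Scheme.{0}} (σ : X ⟶ W)

/-- **Prop. (1.2) 1) at a stage** (tree theorem `Lipman1969_1_2_holds`): a normal two-dimensional local ring of an
integral scheme birational and of finite type over a rational `Spec S` has a rational singularity.
[cite: Lipman1969, Proposition (1.2) 1) (p. 199)] -/
theorem hasRationalSingularity_stalk_of_stage (hdim : ringKrullDim S = 2) (hrat : HasRationalSingularity S)
    (hg : IsBirational g) (w : W) (hw : IsIntegrallyClosed (W.presheaf.stalk w))
    (hw2 : ringKrullDim (W.presheaf.stalk w) = 2) : HasRationalSingularity (W.presheaf.stalk w) :=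
  (Lipman12B.Lipman1969_1_2_holds S hdim hrat W g hg).1 w hw hw2

/-- **(*) p. 203 at a non-regular normal point of a stage: `𝔪_w·𝒪_{X_w}` is an effective Cartier divisor** on the
desingularization `X_w = X ×_W Spec 𝒪_{W,w} → Spec 𝒪_{W,w}` induced by a resolution `σ : X → W`.
[cite: Lipman1969, Section 2, (*) (p. 203); Proposition (3.1) (p. 203); Theorem (4.1), proof (p. 204)] -/
theorem isEffectiveCartier_baseIdeal_maximalIdeal_stalk_of_stage [IsNoetherian W] [IsNoetherian X]
    (hdim : ringKrullDim S = 2) (hrat : HasRationalSingularity S) (hg : IsBirational g) (hσ : IsResolution σ)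
    (w : W) (hw : IsIntegrallyClosed (W.presheaf.stalk w)) (hw2 : ringKrullDim (W.presheaf.stalk w) = 2)
    (hwsing : ¬ IsRegularLocalRing (W.presheaf.stalk w)) :
    IsEffectiveCartier (Scheme.IdealSheafData.ofIdealTop ((maximalIdeal (W.presheaf.stalk w)).map
      (algebraMapΓ (A := W.presheaf.stalk w) (pullback.snd σ (W.fromSpecStalk w))))) := by
  haveI := hw
  have hres : IsResolution (X := Spec (.of (W.presheaf.stalk w))) (pullback.snd σ (W.fromSpecStalk w)) :=
    hσ.pullback_snd_fromSpecStalk w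
  exact @isEffectiveCartier_baseIdeal_maximalIdeal (W.presheaf.stalk w) _ inferInstance _ _ hw _
    (pullback.snd σ (W.fromSpecStalk w)) hw2 (hasRationalSingularity_stalk_of_stage g hdim hrat hg w hw hw2)
    hwsing hres

/-- **`X_w` is a desingularization of the quadratic transform of `Spec 𝒪_{W,w}`**: for every blowing up
`b : V → Spec 𝒪_{W,w}` of the maximal ideal there is `τ : X_w → V` with `τ ≫ b = (X_w → Spec 𝒪_{W,w})` and
`IsResolution τ`. [cite: Lipman1969, Section 2, (*) (p. 203); Theorem (4.1), proof (pp. 204–205)] -/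
theorem exists_isResolution_fac_stalk_of_stage [IsNoetherian W] [IsNoetherian X]
    (hdim : ringKrullDim S = 2) (hrat : HasRationalSingularity S) (hg : IsBirational g) (hσ : IsResolution σ)
    (w : W) (hw : IsIntegrallyClosed (W.presheaf.stalk w)) (hw2 : ringKrullDim (W.presheaf.stalk w) = 2)
    (hwsing : ¬ IsRegularLocalRing (W.presheaf.stalk w)) {V : Scheme.{0}}
    {b : V ⟶ Spec (W.presheaf.stalk w)} (hb : IsBlowup b (affineBlowup.idealSheaf (maximalIdeal (W.presheaf.stalk w)))) :
    ∃ τ : pullback σ (W.fromSpecStalk w) ⟶ V, τ ≫ b = pullback.snd σ (W.fromSpecStalk w) ∧ IsResolution τ := by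
  haveI := hw
  have hres : IsResolution (X := Spec (.of (W.presheaf.stalk w))) (pullback.snd σ (W.fromSpecStalk w)) :=
    hσ.pullback_snd_fromSpecStalk w
  exact @exists_isResolution_fac_of_isBlowup_maximalIdeal (W.presheaf.stalk w) _ inferInstance _ _ hw _
    (pullback.snd σ (W.fromSpecStalk w)) hw2 (hasRationalSingularity_stalk_of_stage g hdim hrat hg w hw hw2)
    hwsing hres V b hb

end Summit.ResolutionOfSingularities.ResolutionOfSingularities.Theorems.NoZeno.QuadraticTransform

end

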